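import Summits.ResolutionOfSingularities.ResolutionOfSingularities.Theorems.FrobeniusLadderFRationalModificationTestElement
import Literature.RingTheory.TightClosure.TestElements
import Summits.ResolutionOfSingularities.ResolutionOfSingularities.Theorems.FrobeniusLadderFRationalModificationCover
import Literature.AlgebraicGeometry.Resolution.EffectiveCartierStalks
import Literature.AlgebraicGeometry.Resolution.MarkedIdealsLemmas
import HarnessLib

/-!
# Crux `FRationalModification` — the divisor certificate along an effective CARTIER divisor (line `Sketch`, v7)

Support lemmas for crux stmt-ResolutionOfSingularities-15316
(`Summit.ResolutionOfSingularities.ResolutionOfSingularities.Theses.FrobeniusLadder.FRationalModification`,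
route `FrobeniusLadder`), filed by the line lead (line `Sketch`, skeleton v7, lead cycle 3).

The certificate branch of the open stub `stub_cover` is stated at ONE stalk `𝒪_{W,w}` with an
element `g`. A (D+)-construction (card finj-exceptional-divisor-inversion; the "Cartier hull of
the exceptional locus") holds instead a GLOBAL effective Cartier divisor `D ⊂ W` (an ideal sheaf
with `IsEffectiveCartier`, tree `Blowups.lean`) such that `W` is regular off `Supp D` and `D` is
Cohen–Macaulay and F-injective at its points. This file translates: at `w ∈ Supp D` the stalk
`D_w` is principal, `D_w = (g)` with `g ∈ 𝔪_w` a non-zero-divisor (`exists_localEquation`), the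
local ring of `D` at `w` is `𝒪_{W,w}/D_w = 𝒪_{W,w}/(g)`, and "regular at the generizations off
`Supp D`" is "regular wherever `g` becomes a unit" (`not_isUnit_of_mem_support`); so, over an
F-finite field and assuming the test-element theorem `HochsterHuneke1989_thm34`
(`isFRational_stalk_of_divisorCertificate'`), **`𝒪_{W,w}` is F-rational at every
point `w ∈ Supp D` at which `𝒪_{W,w}` is a domain and `𝒪_{W,w}/D_w` is Cohen–Macaulay and
F-injective** (`isFRational_stalk_of_cartierCertificate`) — Fedder–Watanabe 1989, Prop. 2.13
along a divisor, in the tree's language.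

* `isFRational_of_divisorCertificate_of_isRegularRing_away`, `isFRational_stalk_of_divisorCertificate`,
  `isFRational_stalk_of_divisorCertificate'` — the stalkwise certificate with its test-element clause
  discharged by `HochsterHuneke1989_thm34` (F-finite `S`, resp. `k` F-finite via
  `TestElement.isFFinite_stalk`; `S_g` regular, resp. regular at the generizations where `g` is a unit
  via `TestElement.isRegularRing_away_of_generizations`);
* `stalkIdeal_eq_map_stalkSpecializes` — `D_{x'} = D_x 𝒪_{X,x'}` for `x' ⤳ x`;
* `exists_localEquation`, `not_isUnit_of_mem_support` — local equations of effective Cartier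
  divisors at points of the support and their behaviour under generization;
* `isFRational_stalk_of_cartierCertificate` — the consumer theorem.
-/

-- single-problem summit: the doubled namespace component `ResolutionOfSingularities` is forced
set_option linter.dupNamespace false

noncomputable section

open CategoryTheory AlgebraicGeometry TopologicalSpace
open IsLocalRing Literature.RingTheory.TightClosure Literature.AlgebraicGeometry.Resolution
open Summit.ResolutionOfSingularities.ResolutionOfSingularities.Theorems.FRationalModification

namespace Summit.ResolutionOfSingularities.ResolutionOfSingularities.Theorems.FRationalModification.CartierCertificate

/-! ## The divisor certificate with its test-element clause discharged (F-finite, regular off `V(g)`) -/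

/-- **Divisor certificate over an F-finite stalk, Fedder–Watanabe shape.** A Noetherian local F-finite
domain `S` of characteristic `p` with `g ∈ 𝔪_S`, `g ≠ 0`, such that `S/(g)` is Cohen–Macaulay and
F-injective (every system of parameters of `S/(g)` a weakly regular sequence generating a
Frobenius-closed ideal) and `S_g` is regular, is F-rational: the test-element clause comes from
`HochsterHuneke1989_thm34` (`HochsterHuneke1989_thm34.parameter_testElement`) and the rest is
`Cover.isFRational_of_divisorCertificate` (Fedder–Watanabe 1989, Prop. 2.13, landed chain).
[cite: FedderWatanabe1989, Prop. 2.13; HochsterHuneke1989, Thm. 3.4] -/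
theorem isFRational_of_divisorCertificate_of_isRegularRing_away (hHH : HochsterHuneke1989_thm34)
    (p : ℕ) [Fact p.Prime] {S : Type} [CommRing S] [IsLocalRing S] [IsNoetherianRing S] [IsDomain S]
    [CharP S p] (hF : IsFFinite p 1 S) {g : S} (hgm : g ∈ maximalIdeal S) (hg0 : g ≠ 0)
    (hreg : IsRegularRing (Localization.Away g))
    (hD : ∀ d : ℕ, ringKrullDim (S ⧸ Ideal.span {g}) = d → ∀ t : Fin d → S ⧸ Ideal.span {g},
      (Ideal.span (Set.range t)).radical.IsMaximal →
        RingTheory.Sequence.IsWeaklyRegular (S ⧸ Ideal.span {g}) (List.ofFn t) ∧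
        ∀ y : S ⧸ Ideal.span {g}, (∃ e : ℕ, y ^ p ^ e ∈
          Ideal.span ((fun z : S ⧸ Ideal.span {g} => z ^ p ^ e) ''
            (Ideal.span (Set.range t) : Set (S ⧸ Ideal.span {g})))) →
          y ∈ Ideal.span (Set.range t)) :
    IsFRational S p :=
  Cover.isFRational_of_divisorCertificate p hgm hg0 hD (hHH.parameter_testElement p hF hg0 hreg)

/-- **Divisor certificate at a stalk of a `k`-scheme, `k` F-finite** (e.g. perfect): for
`f : X → Spec k` locally of finite type, `x ∈ X` with `𝒪_{X,x}` a domain, and `g ∈ 𝔪_x`, `g ≠ 0`,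
such that `𝒪_{X,x}/(g)` is Cohen–Macaulay and F-injective (in its own s.o.p. language) and `𝒪_{X,x}`
is regular off `V(g)` (`(𝒪_{X,x})_g` a regular ring), the stalk `𝒪_{X,x}` is F-rational — assuming
`HochsterHuneke1989_thm34`. This is the certificate branch of `stub_cover` (line `Sketch`, v7) with
its test-element clause discharged by geometry. [cite: FedderWatanabe1989, Prop. 2.13;
HochsterHuneke1989, Thm. 3.4] -/
theorem isFRational_stalk_of_divisorCertificate (hHH : HochsterHuneke1989_thm34) {p : ℕ}
    [Fact p.Prime] {k : Type} [Field k] [CharP k p] (hk : IsFFinite p 1 k) {X : Scheme.{0}}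
    (f : X ⟶ Spec (.of k)) [LocallyOfFiniteType f] (x : X) [IsDomain (X.presheaf.stalk x)]
    [CharP (X.presheaf.stalk x) p] {g : X.presheaf.stalk x}
    (hgm : g ∈ maximalIdeal (X.presheaf.stalk x)) (hg0 : g ≠ 0)
    (hreg : IsRegularRing (Localization.Away g))
    (hD : ∀ d : ℕ, ringKrullDim (X.presheaf.stalk x ⧸ Ideal.span {g}) = d →
      ∀ t : Fin d → X.presheaf.stalk x ⧸ Ideal.span {g},
        (Ideal.span (Set.range t)).radical.IsMaximal →
          RingTheory.Sequence.IsWeaklyRegular (X.presheaf.stalk x ⧸ Ideal.span {g}) (List.ofFn t) ∧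
          ∀ y : X.presheaf.stalk x ⧸ Ideal.span {g}, (∃ e : ℕ, y ^ p ^ e ∈
            Ideal.span ((fun z : X.presheaf.stalk x ⧸ Ideal.span {g} => z ^ p ^ e) ''
              (Ideal.span (Set.range t) : Set (X.presheaf.stalk x ⧸ Ideal.span {g})))) →
            y ∈ Ideal.span (Set.range t)) :
    IsFRational (X.presheaf.stalk x) p := by
  haveI : IsLocallyNoetherian X := LocallyOfFiniteType.isLocallyNoetherian f
  exact isFRational_of_divisorCertificate_of_isRegularRing_away hHH p (TestElement.isFFinite_stalk hk f x)
    hgm hg0 hreg hD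
/-- **Divisor certificate at a stalk, geometric form** (the hypothesis a (D+)-construction checks):
`f : X → Spec k` locally of finite type with `k` F-finite of characteristic `p`, `x ∈ X` with
`𝒪_{X,x}` a domain, `g ∈ 𝔪_x`, `g ≠ 0`, such that `𝒪_{X,x}/(g)` is Cohen–Macaulay and F-injective and
`X` is regular at every generization of `x` where `g` is a unit; then, assuming
`HochsterHuneke1989_thm34`, the stalk `𝒪_{X,x}` is F-rational (`isRegularRing_away_of_generizations`
+ `isFRational_stalk_of_divisorCertificate`). [cite: FedderWatanabe1989, Prop. 2.13;
HochsterHuneke1989, Thm. 3.4] -/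
theorem isFRational_stalk_of_divisorCertificate' (hHH : HochsterHuneke1989_thm34) {p : ℕ}
    [Fact p.Prime] {k : Type} [Field k] [CharP k p] (hk : IsFFinite p 1 k) {X : Scheme.{0}}
    (f : X ⟶ Spec (.of k)) [LocallyOfFiniteType f] (x : X) [IsDomain (X.presheaf.stalk x)]
    [CharP (X.presheaf.stalk x) p] {g : X.presheaf.stalk x}
    (hgm : g ∈ maximalIdeal (X.presheaf.stalk x)) (hg0 : g ≠ 0)
    (hreg : ∀ (x' : X) (hx : x' ⤳ x), IsUnit ((X.presheaf.stalkSpecializes hx).hom g) →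
      IsRegularLocalRing (X.presheaf.stalk x'))
    (hD : ∀ d : ℕ, ringKrullDim (X.presheaf.stalk x ⧸ Ideal.span {g}) = d →
      ∀ t : Fin d → X.presheaf.stalk x ⧸ Ideal.span {g},
        (Ideal.span (Set.range t)).radical.IsMaximal →
          RingTheory.Sequence.IsWeaklyRegular (X.presheaf.stalk x ⧸ Ideal.span {g}) (List.ofFn t) ∧
          ∀ y : X.presheaf.stalk x ⧸ Ideal.span {g}, (∃ e : ℕ, y ^ p ^ e ∈
            Ideal.span ((fun z : X.presheaf.stalk x ⧸ Ideal.span {g} => z ^ p ^ e) ''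
              (Ideal.span (Set.range t) : Set (X.presheaf.stalk x ⧸ Ideal.span {g})))) →
            y ∈ Ideal.span (Set.range t)) :
    IsFRational (X.presheaf.stalk x) p := by
  haveI : IsLocallyNoetherian X := LocallyOfFiniteType.isLocallyNoetherian f
  exact isFRational_stalk_of_divisorCertificate hHH hk f x hgm hg0
    (TestElement.isRegularRing_away_of_generizations x g hreg) hD

/-! ## Along a global effective Cartier divisor -/

/-- **The stalk of an ideal sheaf at a generization is the extension of its stalk**: for
`x' ⤳ x`, `I_{x'} = I_x · 𝒪_{X,x'}` along the specialization map `𝒪_{X,x} → 𝒪_{X,x'}` (both are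
generated by the germs of `I(U)` for an affine open `U ∋ x`, which also contains `x'`; and
`germ_{x'} = stalkSpecializes ∘ germ_x`). [folklore] -/
theorem stalkIdeal_eq_map_stalkSpecializes {X : Scheme.{0}} (I : X.IdealSheafData) {x x' : X}
    (h : x' ⤳ x) :
    stalkIdeal I x' = (stalkIdeal I x).map (X.presheaf.stalkSpecializes h).hom := by
  obtain ⟨U, hU, hxU, -⟩ :=
    exists_isAffineOpen_mem_and_subset (X := X) (x := x) (U := ⊤) (Opens.mem_top x)
  have hx'U : x' ∈ U := h.mem_open U.2 hxU
  rw [stalkIdeal_eq_map_germ I ⟨U, hU⟩ hx'U, stalkIdeal_eq_map_germ I ⟨U, hU⟩ hxU, Ideal.map_map]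
  congr 1
  rw [← CommRingCat.hom_comp, TopCat.Presheaf.germ_stalkSpecializes]

/-- **Local equation of an effective Cartier divisor at a point of its support.** For an
effective Cartier divisor `D` (ideal sheaf) on a scheme `X` and `x ∈ Supp D`, the stalk `D_x` is
generated by a single `g ∈ 𝔪_x`, `g` a non-zero-divisor (in particular `g ≠ 0`), and `g` becomes
a unit at every generization `x' ⤳ x` outside `Supp D` (there `D_{x'} = (1)` is generated by the
image of `g`). [cite: StacksProject, Tag 01WS; folklore] -/
theorem exists_localEquation {X : Scheme.{0}} {D : X.IdealSheafData} (hD : IsEffectiveCartier D)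
    {x : X} (hx : x ∈ D.support) :
    ∃ g : X.presheaf.stalk x, g ∈ maximalIdeal (X.presheaf.stalk x) ∧ g ≠ 0 ∧
      stalkIdeal D x = Ideal.span {g} ∧
      ∀ (x' : X) (hx' : x' ⤳ x), x' ∉ D.support →
        IsUnit ((X.presheaf.stalkSpecializes hx').hom g) := by
  obtain ⟨g, hg, hDg⟩ := hD.mem_cartierLocus x
  have hgm : g ∈ maximalIdeal (X.presheaf.stalk x) :=
    (mem_support_iff_stalkIdeal_le D x).mp hx (hDg ▸ Ideal.mem_span_singleton_self g)
  refine ⟨g, hgm, nonZeroDivisors.ne_zero hg, hDg, fun x' hx' hx's => ?_⟩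
  have htop : Ideal.span {(X.presheaf.stalkSpecializes hx').hom g} = ⊤ := by
    rw [← Set.image_singleton, ← Ideal.map_span, ← hDg, ← stalkIdeal_eq_map_stalkSpecializes D hx',
      stalkIdeal_eq_top_of_not_mem_support hx's]
  exact Ideal.span_singleton_eq_top.mp htop

/-- At a generization INSIDE the support the local equation stays a non-unit: so "`X` regular at
the generizations of `x` off `Supp D`" is the same as "`X` regular at the generizations where the
local equation `g` becomes a unit" (the hypothesis of
`TestElement.isRegularRing_away_of_generizations`). [folklore] -/
theorem not_isUnit_of_mem_support {X : Scheme.{0}} {D : X.IdealSheafData} {x x' : X} (hx' : x' ⤳ x)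
    {g : X.presheaf.stalk x} (hDg : stalkIdeal D x = Ideal.span {g}) (hx's : x' ∈ D.support) :
    ¬ IsUnit ((X.presheaf.stalkSpecializes hx').hom g) := by
  intro hu
  have hle := (mem_support_iff_stalkIdeal_le D x').mp hx's
  rw [stalkIdeal_eq_map_stalkSpecializes D hx', hDg, Ideal.map_span, Set.image_singleton] at hle
  exact (maximalIdeal.isMaximal _).ne_top
    (top_le_iff.mp ((Ideal.span_singleton_eq_top.mpr hu).symm.le.trans hle))

/-- **F-rationality along a Cohen–Macaulay F-injective effective Cartier divisor with regular
complement** (Fedder–Watanabe 1989, Prop. 2.13, geometric form; over an F-finite field, assuming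
the test-element theorem `HochsterHuneke1989_thm34`). Let `f : X → Spec k` be locally of finite
type, `k` F-finite of characteristic `p`, `D` an effective Cartier divisor on `X`, `x ∈ Supp D`
with `𝒪_{X,x}` a domain, such that `X` is regular at every generization of `x` outside `Supp D`
and the local ring `𝒪_{X,x}/D_x` of `D` at `x` is Cohen–Macaulay and F-injective (every system of
parameters a weakly regular sequence generating a Frobenius-closed ideal). Then `𝒪_{X,x}` is
F-rational. [cite: FedderWatanabe1989, Prop. 2.13; HochsterHuneke1989, Thm. 3.4] -/
theorem isFRational_stalk_of_cartierCertificate (hHH : HochsterHuneke1989_thm34) {p : ℕ}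
    [Fact p.Prime] {k : Type} [Field k] [CharP k p] (hk : IsFFinite p 1 k) {X : Scheme.{0}}
    (f : X ⟶ Spec (.of k)) [LocallyOfFiniteType f] {D : X.IdealSheafData}
    (hD : IsEffectiveCartier D) {x : X} (hx : x ∈ D.support) [IsDomain (X.presheaf.stalk x)]
    [CharP (X.presheaf.stalk x) p]
    (hreg : ∀ (x' : X), x' ⤳ x → x' ∉ D.support → IsRegularLocalRing (X.presheaf.stalk x'))
    (hcert : ∀ d : ℕ, ringKrullDim (X.presheaf.stalk x ⧸ stalkIdeal D x) = d →
      ∀ t : Fin d → X.presheaf.stalk x ⧸ stalkIdeal D x,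
        (Ideal.span (Set.range t)).radical.IsMaximal →
          RingTheory.Sequence.IsWeaklyRegular (X.presheaf.stalk x ⧸ stalkIdeal D x) (List.ofFn t) ∧
          ∀ y : X.presheaf.stalk x ⧸ stalkIdeal D x, (∃ e : ℕ, y ^ p ^ e ∈
            Ideal.span ((fun z : X.presheaf.stalk x ⧸ stalkIdeal D x => z ^ p ^ e) ''
              (Ideal.span (Set.range t) : Set (X.presheaf.stalk x ⧸ stalkIdeal D x)))) →
            y ∈ Ideal.span (Set.range t)) :
    IsFRational (X.presheaf.stalk x) p := by
  obtain ⟨g, hgm, hg0, hDg, -⟩ := exists_localEquation hD hx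
  have hreg' : ∀ (x' : X) (hx' : x' ⤳ x), IsUnit ((X.presheaf.stalkSpecializes hx').hom g) →
      IsRegularLocalRing (X.presheaf.stalk x') := fun x' hx' hu =>
    hreg x' hx' fun hs => not_isUnit_of_mem_support hx' hDg hs hu
  revert hcert
  rw [hDg]
  intro hcert
  exact isFRational_stalk_of_divisorCertificate' hHH hk f x hgm hg0 hreg' hcert

end Summit.ResolutionOfSingularities.ResolutionOfSingularities.Theorems.FRationalModification.CartierCertificate

end
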